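import Literature.NumberTheory.Sieve.HeathBrownCubicTwistedDefs
import HarnessLib

/-!
# Heath-Brown's Lemma 3.10 for a twisted weight `w(β̂) F_β`: §11 p. 68 (Cauchy layer) and §11 p. 70 (`S₃`)

D. R. Heath-Brown, *Primes represented by `x³ + 2y³`*, Acta Math. 186 (2001), §11, for the twisted
weight `w(β̂)F_β` (`|w| ≤ 1`) of Heath-Brown–Moroz, Proc. LMS 88 (2004), Prop. 4.2 (ii): the tree's d = 1
proofs (`HeathBrownCubicTypeIICauchy`, `…OffDiag`, `…Forms`) re-run word for word with `|wF| ≤ |F|`.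
PROVED here: `|wF| ≤ |F|`, `(wF)² ≤ 81τ²`, support of `wF`; `S(w) = S₁(w) + S₂(w)`; `S₁(w) ≤ S₁` and the
absolute bound `S₁(w) ≤ C X²(log X)^e`; `S₂(w) = ∑_{pairs} wF·wF·#{α̂} = S₃(w) + S₄(w)`; the termwise bound
and `|S₃(w)| ≤ 2(∑ F²)·Δ₀(6T + Δ₀)(56X/T² + 1)²` (the UNtwisted `∑ F²`, so the tree's Lemma 4.5 bound
applies); `S₄(w) = 2S₄⁺(w)`; `S₄⁺(w) = ∑_{PP} wF·wF` over the tree's support set `PP`.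

## References

* D. R. Heath-Brown, Acta Math. 186 (2001), §11 pp. 68–71, §12 p. 72. [cite: HeathBrownActa2001, §11 p. 68]
* D. R. Heath-Brown, B. Z. Moroz, Proc. London Math. Soc. 88 (2004), Prop. 4.2. [cite: HeathBrownMoroz2004, Proposition 4.2]

## Mathlib / tree search

Tree: `HeathBrownCubicTypeIICauchy` (`Ssum_eq_S1_add_S2`, `Fb_sq_le`, `exists_S1_bound`),
`HeathBrownCubicTypeIIOffDiag` (`support_of_Fb_ne_zero`, `nAB_le_two`, `card_b2_le`, `abs_S3sum_le`),
`HeathBrownCubicTypeIIForms` (`nAB_eq`, `S4sum_eq_two_mul_S4plus`), `HeathBrownCubicTypeIILocalise` (`PP`).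
-/

noncomputable section

open Finset NumberField

namespace Literature.NumberTheory.Sieve.CubicSieve.Twisted

open LFunctions.CubeRootTwoField CubicPrimes CubicSieve

variable {X η τ V T : ℝ} {k : ℕ} {m : Fin k → ℕ} {w : ℤ × ℤ × ℤ → ℝ}

/-! ### The twisted weight: size and support -/

/-- `|w F| ≤ |F|` for `|w| ≤ 1`. [cite: HeathBrownMoroz2004, Proposition 4.2] -/
theorem abs_Fb_le (hw : ∀ b, |w b| ≤ 1) (b : ℤ × ℤ × ℤ) :
    |Fb X τ m V T w b| ≤ |CubicSieve.Fb X τ m V T b| := by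
  rw [Fb_def, abs_mul]
  exact (mul_le_mul_of_nonneg_right (hw b) (abs_nonneg _)).trans_eq (one_mul _)

/-- `(w F)² ≤ F²` for `|w| ≤ 1`. [cite: HeathBrownMoroz2004, Proposition 4.2] -/
theorem Fb_sq_le_sq (hw : ∀ b, |w b| ≤ 1) (b : ℤ × ℤ × ℤ) :
    Fb X τ m V T w b ^ 2 ≤ CubicSieve.Fb X τ m V T b ^ 2 := by
  rw [← sq_abs, ← sq_abs (CubicSieve.Fb X τ m V T b)]
  exact pow_le_pow_left₀ (abs_nonneg _) (abs_Fb_le hw b) 2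

open scoped Classical in
/-- `(wF_β)² ≤ 81 τ((β))²`. [cite: HeathBrownActa2001, §11 p. 68] -/
theorem Fb_sq_le (hw : ∀ b, |w b| ≤ 1) (hX : 1 < X) (hτ : 0 < τ) (hτ1 : τ ≤ 1) {n : ℕ} {m : Fin (n + 1) → ℕ}
    (hm : CoreAdmissible τ m) (b : ℤ × ℤ × ℤ) :
    Fb X τ m V T w b ^ 2 ≤ 81 * (idealDivisorCount (Ideal.span {coordElt b}) : ℝ) ^ 2 :=
  (Fb_sq_le_sq hw b).trans (CubicSieve.Fb_sq_le hX hτ hτ1 hm b)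

/-- The twisted weight is supported inside the support of `F_β`. [cite: HeathBrownMoroz2004, Proposition 4.2] -/
theorem Fb_ne_zero_of_ne_zero {b : ℤ × ℤ × ℤ} (h : Fb X τ m V T w b ≠ 0) : CubicSieve.Fb X τ m V T b ≠ 0 :=
  fun h0 => h (by rw [Fb_def, h0, mul_zero])

/-- `wF_β ≠ 0` forces: `β` in the window, `β̂` primitive, `V < N(β) ≤ 2V`. [cite: HeathBrownActa2001, §11 p. 68] -/
theorem support_of_Fb_ne_zero {b : ℤ × ℤ × ℤ} (h : Fb X τ m V T w b ≠ 0) :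
    InWindow T (coordElt b) ∧ IsPrimitiveVec b ∧ V < (Ideal.absNorm (Ideal.span {coordElt b}) : ℝ) ∧
      (Ideal.absNorm (Ideal.span {coordElt b}) : ℝ) ≤ 2 * V :=
  CubicSieve.support_of_Fb_ne_zero (Fb_ne_zero_of_ne_zero h)

/-! ### `S = S₁ + S₂` and `S₁(w) ≤ S₁` -/

open scoped Classical in
/-- **`S(w) = S₁(w) + S₂(w)`**. [cite: HeathBrownActa2001, §11 p. 68] -/
theorem Ssum_eq_S1_add_S2 : Ssum X η τ m V T w = S1sum X η τ m V T w + S2sum X η τ m V T w := by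
  classical
  rw [Ssum, S1sum, S2sum, ← sum_add_distrib]
  refine sum_congr rfl fun a _ => ?_
  set G : ℤ × ℤ × ℤ → ℝ := fun b => if Wab X η a b then Fb X τ m V T w b else 0 with hG
  have hsq : innerSum X η τ m V T w a ^ 2 = ∑ bb ∈ Bbox T ×ˢ Bbox T, G bb.1 * G bb.2 := by
    rw [innerSum, sq, sum_mul_sum, sum_product]
  rw [hsq, ← diag_union_offDiag, sum_union (disjoint_diag_offDiag _)]
  congr 1
  · rw [diag, sum_map]
    refine sum_congr rfl fun b _ => ?_
    simp only [hG, Function.Embedding.coeFn_mk]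
    split_ifs <;> ring
  · refine sum_congr rfl fun bb _ => ?_
    simp only [hG]
    split_ifs <;> simp_all

open scoped Classical in
/-- **`S₁(w) ≤ S₁`** (termwise `(wF)² ≤ F²`). [cite: HeathBrownActa2001, §11 p. 68] -/
theorem S1sum_le_S1sum (hw : ∀ b, |w b| ≤ 1) : S1sum X η τ m V T w ≤ CubicSieve.S1sum X η τ m V T := by
  classical
  rw [S1sum, CubicSieve.S1sum]
  refine sum_le_sum fun a _ => sum_le_sum fun b _ => ?_
  split_ifs
  · exact Fb_sq_le_sq hw b
  · exact le_rfl

open scoped Classical in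
/-- `S(w) ≥ 0`. [cite: HeathBrownActa2001, §11 p. 68] -/
theorem Ssum_nonneg : 0 ≤ Ssum X η τ m V T w := sum_nonneg fun _ _ => sq_nonneg _

/-- **`S₁(w) ≪ X² (log X)^c`**: the tree's absolute `C, e` of `exists_S1_bound` work for every twist
`|w| ≤ 1`. [cite: HeathBrownActa2001, §11 p. 68] -/
theorem exists_S1_bound :
    ∃ C e : ℝ, 0 < C ∧ 0 ≤ e ∧ ∀ (X η τ V T : ℝ) (n : ℕ) (m : Fin (n + 1) → ℕ) (w : ℤ × ℤ × ℤ → ℝ),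
      (∀ b, |w b| ≤ 1) → 2 ≤ X → 0 ≤ η → η ≤ 1 → 0 < τ → τ ≤ 1 → 0 < T → T ^ 3 = V →
        CoreAdmissible τ m → S1sum X η τ m V T w ≤ C * X ^ 2 * Real.log X ^ e := by
  obtain ⟨C, e, hC, he, h⟩ := CubicSieve.exists_S1_bound
  exact ⟨C, e, hC, he, fun X η τ V T n m w hw hX hη0 hη1 hτ hτ1 hT hTV hm =>
    (S1sum_le_S1sum hw).trans (h X η τ V T n m hX hη0 hη1 hτ hτ1 hT hTV hm)⟩

/-! ### `S₂ = S₃ + S₄` and the bound for `S₃` -/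

open scoped Classical in
/-- **`S₂(w) = ∑_{β₁ ≠ β₂} wF_{β₁}wF_{β₂} · #{α̂}`**. [cite: HeathBrownActa2001, §11 p. 68] -/
theorem S2sum_eq_sum_offDiag :
    S2sum X η τ m V T w = ∑ bb ∈ (Bbox T).offDiag, Fb X τ m V T w bb.1 * Fb X τ m V T w bb.2 * nAB X η T bb := by
  classical
  rw [S2sum, sum_comm]
  refine sum_congr rfl fun bb _ => ?_
  rw [nAB, card_eq_sum_ones, Nat.cast_sum, mul_sum, sum_filter, sum_filter]
  refine sum_congr rfl fun a _ => ?_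
  by_cases ha : IsPrimitiveVec a
  · by_cases hW : Wab X η a bb.1 ∧ Wab X η a bb.2
    · rw [if_pos ha, if_pos hW, if_pos ⟨ha, hW⟩]; simp
    · rw [if_pos ha, if_neg hW, if_neg (fun h => hW h.2)]
  · rw [if_neg ha, if_neg (fun h => ha h.1)]

open scoped Classical in
/-- `S₂(w) = S₃(w) + S₄(w)`. [cite: HeathBrownActa2001, §11 p. 70] -/
theorem S2sum_eq_S3_add_S4 (Δ₀ : ℝ) :
    S2sum X η τ m V T w = S3sum X η τ m V T w Δ₀ + S4sum X η τ m V T w Δ₀ := by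
  classical
  rw [S2sum_eq_sum_offDiag, S3sum, S4sum, ← sum_filter_add_sum_filter_not _ (fun bb => (Dhcf bb : ℝ) ≤ Δ₀)]
  congr 1
  refine sum_congr ?_ fun _ _ => rfl
  ext bb; simp only [mem_filter, not_le]

open scoped Classical in
/-- **The termwise bound `|wF_{β₁}wF_{β₂}| · #{α̂} ≤ F_{β₁}² + F_{β₂}²`** (at most two `α̂`, `|w| ≤ 1`).
[cite: HeathBrownActa2001, §11 p. 70] -/
theorem abs_term_le (hw : ∀ b, |w b| ≤ 1) (hX : 0 ≤ X) (hη1 : η ≤ 1) {bb : (ℤ × ℤ × ℤ) × (ℤ × ℤ × ℤ)}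
    (hbb : bb ∈ (Bbox T).offDiag) :
    |Fb X τ m V T w bb.1 * Fb X τ m V T w bb.2 * nAB X η T bb| ≤
      CubicSieve.Fb X τ m V T bb.1 ^ 2 + CubicSieve.Fb X τ m V T bb.2 ^ 2 := by
  classical
  by_cases hn : nAB X η T bb = 0
  · rw [hn]; simp; positivity
  by_cases hF : Fb X τ m V T w bb.1 = 0
  · rw [hF]; simp; positivity
  obtain ⟨-, hprim, -, -⟩ := support_of_Fb_ne_zero hF
  obtain ⟨a, -, -, hW1, hW2⟩ := exists_of_nAB_ne_zero hn
  have hne : bb.1 ≠ bb.2 := (mem_offDiag.mp hbb).2.2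
  have hv : cross3 bb.1 bb.2 ≠ 0 := cross3_ne_zero_of_Wab hX hη1 hprim hne hW1 hW2
  have hn2 : (nAB X η T bb : ℝ) ≤ 2 := by exact_mod_cast nAB_le_two hv
  rw [abs_mul, abs_mul, Nat.abs_cast]
  have e1 := abs_Fb_le (X := X) (τ := τ) (m := m) (V := V) (T := T) hw bb.1
  have e2 := abs_Fb_le (X := X) (τ := τ) (m := m) (V := V) (T := T) hw bb.2
  set A := |CubicSieve.Fb X τ m V T bb.1|
  set B := |CubicSieve.Fb X τ m V T bb.2|
  have h2ab : 2 * (A * B) ≤ CubicSieve.Fb X τ m V T bb.1 ^ 2 + CubicSieve.Fb X τ m V T bb.2 ^ 2 := by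
    rw [← sq_abs (CubicSieve.Fb X τ m V T bb.1), ← sq_abs (CubicSieve.Fb X τ m V T bb.2)]
    nlinarith [sq_nonneg (A - B)]
  have hprod : |Fb X τ m V T w bb.1| * |Fb X τ m V T w bb.2| ≤ A * B :=
    mul_le_mul e1 e2 (abs_nonneg _) (abs_nonneg _)
  calc |Fb X τ m V T w bb.1| * |Fb X τ m V T w bb.2| * (nAB X η T bb : ℝ)
      ≤ (A * B) * 2 := mul_le_mul hprod hn2 (Nat.cast_nonneg _) (by positivity)
    _ ≤ _ := by linarith

open scoped Classical in
/-- **`|S₃(w)| ≤ 2 (∑_{β̂ ∈ Bbox} F_β²) · Δ₀ (6T + Δ₀)(56X/T² + 1)²`** (the UNtwisted `∑ F²`).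
[cite: HeathBrownActa2001, §11 p. 71] -/
theorem abs_S3sum_le (hw : ∀ b, |w b| ≤ 1) (hX : 0 ≤ X) (hη1 : η ≤ 1) (hT : 0 < T) {Δ₀ : ℝ} (hΔ : 0 ≤ Δ₀) :
    |S3sum X η τ m V T w Δ₀| ≤
      2 * (∑ b ∈ Bbox T, CubicSieve.Fb X τ m V T b ^ 2) * (Δ₀ * (6 * T + Δ₀) * (56 * X / T ^ 2 + 1) ^ 2) := by
  classical
  set P := ((Bbox T).offDiag).filter (fun bb => (Dhcf bb : ℝ) ≤ Δ₀ ∧ nAB X η T bb ≠ 0) with hP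
  set g : ℤ × ℤ × ℤ → ℝ := fun b => CubicSieve.Fb X τ m V T b ^ 2 with hg
  have h1 : |S3sum X η τ m V T w Δ₀| ≤ ∑ bb ∈ P, (g bb.1 + g bb.2) := by
    rw [S3sum]
    refine (abs_sum_le_sum_abs _ _).trans ?_
    rw [← sum_filter_of_ne (p := fun bb => nAB X η T bb ≠ 0) (fun bb _ hne => by
      intro h0; apply hne; rw [h0]; simp), filter_filter, ← hP]
    refine sum_le_sum fun bb hbb => ?_
    rw [hP, mem_filter] at hbb
    exact abs_term_le hw hX hη1 hbb.1
  have hPswap : ∀ bb, bb ∈ P ↔ bb.swap ∈ P := by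
    intro bb
    simp only [hP, mem_filter, mem_offDiag, Prod.fst_swap, Prod.snd_swap, Dhcf_swap, nAB_swap]
    tauto
  have h2 : ∑ bb ∈ P, g bb.2 = ∑ bb ∈ P, g bb.1 := by
    refine Finset.sum_nbij' Prod.swap Prod.swap (fun bb hbb => ?_) (fun bb hbb => ?_)
      (fun bb _ => Prod.swap_swap bb) (fun bb _ => Prod.swap_swap bb) (fun bb _ => rfl)
    · exact (hPswap bb).mp hbb
    · exact (hPswap bb).mp hbb
  have h12 : ∑ bb ∈ P, (g bb.1 + g bb.2) = 2 * ∑ bb ∈ P, g bb.1 := by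
    rw [sum_add_distrib, h2]; ring
  set Bnd : ℝ := Δ₀ * (6 * T + Δ₀) * (56 * X / T ^ 2 + 1) ^ 2 with hBnd
  have hBnd0 : 0 ≤ Bnd := by positivity
  have hPsub : P ⊆ Bbox T ×ˢ Bbox T := by
    intro bb hbb
    rw [hP, mem_filter, mem_offDiag] at hbb
    exact mem_product.mpr ⟨hbb.1.1, hbb.1.2.1⟩
  have h3 : ∑ bb ∈ P, g bb.1 ≤ (∑ b ∈ Bbox T, g b) * Bnd := by
    have e : ∑ bb ∈ P, g bb.1 = ∑ b₁ ∈ Bbox T, g b₁ * #((Bbox T).filter (fun b₂ => (b₁, b₂) ∈ P)) := by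
      have : P = (Bbox T ×ˢ Bbox T).filter (fun bb => bb ∈ P) := by
        ext bb; simp only [mem_filter]; exact ⟨fun h => ⟨hPsub h, h⟩, fun h => h.2⟩
      conv_lhs => rw [this]
      rw [sum_filter, sum_product]
      refine sum_congr rfl fun b₁ _ => ?_
      rw [← sum_filter]
      simp only
      rw [sum_const, nsmul_eq_mul, mul_comm]
    rw [e, sum_mul]
    refine sum_le_sum fun b₁ hb₁ => ?_
    by_cases hF : CubicSieve.Fb X τ m V T b₁ = 0
    · simp only [hg, hF]; simp
    refine mul_le_mul_of_nonneg_left ?_ (by positivity)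
    obtain ⟨hw', hprim, -, -⟩ := CubicSieve.support_of_Fb_ne_zero hF
    have hsup := supZ_gt_of_inWindow hT hw'
    refine le_trans ?_ (card_b2_le hT hprim hsup (by positivity : (0 : ℝ) ≤ 7 * X / T) hΔ |>.trans (le_of_eq ?_))
    · refine Nat.cast_le.mpr (card_le_card fun b₂ hb₂ => ?_)
      rw [mem_filter] at hb₂ ⊢
      obtain ⟨hB2, hmem⟩ := hb₂
      rw [hP, mem_filter, mem_offDiag] at hmem
      obtain ⟨⟨-, -, hne⟩, hD, hn⟩ := hmem
      obtain ⟨a, ha, haprim, hW1, hW2⟩ := exists_of_nAB_ne_zero hn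
      have hv : cross3 b₁ b₂ ≠ 0 := cross3_ne_zero_of_Wab hX hη1 hprim hne hW1 hW2
      exact ⟨hB2, hv, hD, supZ_cross3_le_of_Wab ha haprim hW1 hW2 hv⟩
    · rw [hBnd]; congr 2; field_simp; ring
  calc |S3sum X η τ m V T w Δ₀| ≤ ∑ bb ∈ P, (g bb.1 + g bb.2) := h1
    _ = 2 * ∑ bb ∈ P, g bb.1 := h12
    _ ≤ 2 * ((∑ b ∈ Bbox T, g b) * Bnd) := by gcongr
    _ = 2 * (∑ b ∈ Bbox T, CubicSieve.Fb X τ m V T b ^ 2) * Bnd := by rw [hg]; ring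

/-! ### `S₄ = 2 S₄⁺` and `S₄⁺` over the support pairs -/

open scoped Classical in
/-- **`S₄(w) = 2 S₄⁺(w)`** (the two signs of (11.4); `p₁(β₁,β₂) = −p₂(β₂,β₁)`). [cite: HeathBrownActa2001, §12 p. 72] -/
theorem S4sum_eq_two_mul_S4plus (hX : 0 < X) (hη1 : η ≤ 1) (hT : 0 < T) (hTV : T ^ 3 = V) (Δ₀ : ℝ) :
    S4sum X η τ m V T w Δ₀ = 2 * S4plus X η τ m V T w Δ₀ := by
  classical
  set P := ((Bbox T).offDiag).filter (fun bb => Δ₀ < (Dhcf bb : ℝ)) with hP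
  set g : (ℤ × ℤ × ℤ) × (ℤ × ℤ × ℤ) → ℝ := fun bb =>
    if Wab X η (aplus bb) bb.1 ∧ Wab X η (aplus bb) bb.2 then Fb X τ m V T w bb.1 * Fb X τ m V T w bb.2 else 0
    with hg
  have hPswap : ∀ bb, bb ∈ P ↔ bb.swap ∈ P := by
    intro bb
    simp only [hP, mem_filter, mem_offDiag, Prod.fst_swap, Prod.snd_swap, Dhcf_swap]
    tauto
  have hterm : ∀ bb ∈ P, Fb X τ m V T w bb.1 * Fb X τ m V T w bb.2 * nAB X η T bb = g bb + g bb.swap := by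
    intro bb hbb
    rw [hP, mem_filter] at hbb
    by_cases hF : Fb X τ m V T w bb.1 = 0 ∨ Fb X τ m V T w bb.2 = 0
    · have h0 : Fb X τ m V T w bb.1 * Fb X τ m V T w bb.2 = 0 := by
        rcases hF with h | h <;> simp [h]
      simp only [hg, Prod.fst_swap, Prod.snd_swap]
      rw [h0, zero_mul, mul_comm (Fb X τ m V T w bb.2), h0]
      split_ifs <;> simp
    · push Not at hF
      rw [nAB_eq hX hη1 hT hTV hbb.1 (Fb_ne_zero_of_ne_zero hF.1)]
      simp only [hg, Prod.fst_swap, Prod.snd_swap]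
      split_ifs <;> (simp_all [mul_comm]; try ring)
  have hswap_sum : ∑ bb ∈ P, g bb.swap = ∑ bb ∈ P, g bb := by
    refine Finset.sum_nbij' Prod.swap Prod.swap (fun bb hbb => (hPswap bb).mp hbb)
      (fun bb hbb => (hPswap bb).mp hbb) (fun bb _ => Prod.swap_swap bb) (fun bb _ => Prod.swap_swap bb)
      (fun bb _ => rfl)
  rw [S4sum, S4plus, ← hP, sum_congr rfl hterm, sum_add_distrib, hswap_sum]
  ring

open scoped Classical in
/-- `S₄⁺(w)` as the sum of `wF_{β₁}wF_{β₂}` over the tree's support set `PP` (the other terms vanish,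
`wF ≠ 0 ⇒ F ≠ 0`). [cite: HeathBrownActa2001, §12 p. 72] -/
theorem S4plus_eq_sum_PP (Δ₀ : ℝ) :
    S4plus X η τ m V T w Δ₀ = ∑ bb ∈ PP X η τ m V T Δ₀, Fb X τ m V T w bb.1 * Fb X τ m V T w bb.2 := by
  classical
  rw [S4plus, PP]
  rw [← sum_filter_of_ne (p := fun bb => (Wab X η (aplus bb) bb.1 ∧ Wab X η (aplus bb) bb.2) ∧
      CubicSieve.Fb X τ m V T bb.1 ≠ 0 ∧ CubicSieve.Fb X τ m V T bb.2 ≠ 0)]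
  · rw [filter_filter]
    refine sum_congr ?_ fun bb hbb => ?_
    · rfl
    · rw [mem_filter] at hbb; rw [if_pos hbb.2.2.1]
  · intro bb _ hne
    by_cases hW : Wab X η (aplus bb) bb.1 ∧ Wab X η (aplus bb) bb.2
    · rw [if_pos hW] at hne
      exact ⟨hW, Fb_ne_zero_of_ne_zero (mul_ne_zero_iff.mp hne).1, Fb_ne_zero_of_ne_zero (mul_ne_zero_iff.mp hne).2⟩
    · rw [if_neg hW] at hne; exact absurd rfl hne

/-- **`S₄⁺(w) = ∑_{cells} S₅(w)`.** [cite: HeathBrownActa2001, Lemma 12.1] -/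
theorem S4plus_eq_sum_S5 (hX : 0 < X) (hT : 0 < T) (hTV : T ^ 3 = V) {N : ℕ} (hN : 0 < N) {Δ₀ : ℝ} (hΔ : 1 ≤ Δ₀) :
    S4plus X η τ m V T w Δ₀ =
      ∑ c ∈ Trange N Δ₀ (270 * V / X) ×ˢ (Nrange N ×ˢ Nrange N), S5 X η τ m V T w N Δ₀ c := by
  classical
  rw [S4plus_eq_sum_PP]
  simp only [S5]
  exact (sum_fiberwise_of_maps_to (fun bb hbb => cellOf_mem hX hT hTV hN hΔ hbb) _).symm

end Literature.NumberTheory.Sieve.CubicSieve.Twisted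

end
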